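/-
Copyright (c) 2026. All rights reserved.
Released under Apache 2.0 license as described in the file LICENSE.
-/
import Literature.AlgebraicGeometry.ComplexMultiplication.HyperellipticJacobianReflexFields
import Literature.AlgebraicGeometry.ComplexMultiplication.HyperellipticJacobianEndomorphismAlgebras
import Literature.AlgebraicGeometry.ComplexMultiplication.CMAbelianVarietyHomPrimitiveTypes
import Literature.NumberTheory.ComplexMultiplication.CMTypeDistinguishedElementReflexField
import Literature.NumberTheory.ComplexMultiplication.CMTorusSimpleIffPrimitive
import Literature.NumberTheory.ComplexMultiplication.ComplexReflexField
import HarnessLib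

/-!
# GGL 2024 Thm. 3.0, last statement, ACROSS PARITIES: `Hom(X_d, X_{d′}) = 0` between factors of `J_m` at an odd (or
# twice-odd) level and a level divisible by `4`, read through the reflex fields; and the pair `(4, 12)`, where it fails

Layer `Literature/AlgebraicGeometry/ComplexMultiplication`, namespace `…ComplexMultiplication` (§0) and
`…ComplexMultiplication.HyperellipticJacobian` (§§1–3); the sequel of `HyperellipticJacobianReflexFields` (the reflex fields
`K* ⊂ ℂ` of the lower-half types `Φ_m`: `x(ℚ(ζ_m))` for `m` odd or `m ≡ 2 (mod 4)`, `ℚ(x ζ − (x ζ)⁻¹)` of degree `φ(m)/2` for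
`4 ∣ m ≥ 8`, `m ∉ {20, 24, 60}`, `F_{20}, F_{24}, F_{60}` of degrees `2, 2, 4`) and of `HyperellipticJacobianEndomorphismAlgebras`
(§5: `Hom(X_{d_i}, X_{d_j}) = 0` for DISTINCT ODD levels).  THEOREMS ONLY (no definition, no named fact, no `sorry`, no instance).

## The print

A. Gallese, H. Goodson, D. Lombardo, *Monodromy groups and exceptional Hodge classes, I: Fermat Jacobians*, arXiv:2405.20394
[GalleseGoodsonLombardo2024] (held `paper:arxiv-2405.20394`, p0012–p0015 read first-hand).  §3 THM. 3.0 (p0012): «`J_m ∼ ∏_{d ∣ m,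
d ≠ 1,2} X_d` … if `d = 4k` with `d ≠ 20, 24, 60`, then `X_d ∼ Y_d²` … with complex multiplication by `ℚ(ζ_d − ζ_d^{−1})` … if
`d = 20, 24, 60`, then `X_d ∼ Y_d⁴` … **Furthermore, all `X_d` with odd `d` and all `Y_d` are pairwise non-isogenous.**»  The
printed proof (§3.2, p0013) covers the odd levels only («for different odd values of `m ≠ m′` we get abelian varieties
`X_m, X_{m′}` with different CM fields»); §3.5 (p0015) «this lemma, combined with the last statement in Thm. 3.0, yields the
geometric endomorphism algebra of `J_m` for every `m`».

## The argument typed here (reflex fields; Shimura §8.3 Prop. 28, Milne CM Prop. 1.18 (c), Prop. 3.13)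

§0, for ANY two CM pairs `(K₀; Φ₀)`, `(K₁; Φ₁)` realised by `A₀`, `A₁` (tree `IsCMTypeRealisation`): a compatible pair of
embeddings (`∀ τ ∈ Aut(ℂ), τs ∈ Φ₀ ⟺ τt ∈ Φ₁`) forces EQUAL STABILISERS `{τ | τΦ₀ = Φ₀} = {τ | τΦ₁ = Φ₁}` (`Aut(ℂ)` is
transitive on embeddings), hence EQUAL REFLEX FIELDS `ℚ(tr Φ₀) = ℚ(tr Φ₁) ⊂ ℂ` (Prop. 28: `K*` is the fixed field of the
stabiliser — tree `mem_traceField_iff_forall_smul_mem_iff`); by Riemann's theorem in the tree's form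
(`IsCMTypeRealisation.exists_hom_ne_zero_iff`) **`Hom(A₀, A₁) ≠ 0 ⟹ K*(Φ₀) = K*(Φ₁)`**, and isogenous ⟹ the same.  So two
factors whose types have DIFFERENT reflex fields in `ℂ` are orthogonal (`Hom = 0` both ways, not isogenous).
§1 separates the reflex fields of the `Φ_m` by the ROOTS OF UNITY they contain: a reflex field of a type of `ℚ(ζ_m)` lies
in `x(ℚ(ζ_m))`, so a primitive `n`-th root of unity in it has `n ∣ 2m` (Mathlib `IsPrimitiveRoot.dvd_of_isCyclotomicExtension`);
`K*(Φ_m) ∋` a primitive `m`-th (resp. `n`-th) root of unity for `m` odd (resp. `m = 2n`); for `4 ∣ m ≥ 8`, `m ∉ {20,24,60}`,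
`K*(Φ_m) = x(K₁)`, `K₁ = ℚ(ζ_m)^{⟨σ⟩}`, `σ ζ = −ζ⁻¹` (tree `eq_fixedField_and_eq_adjoin_of_primitive_of_four_dvd`), contains NO
root of unity of odd order `≥ 3` (`σ(ζ^j) = ζ^j` forces `ζ^{4j} = 1`) and contains `i` iff `m ≡ 4 (mod 8)`; at `20 ∕ 24 ∕ 60`
the degrees `2, 2, 4` exclude primitive `5`-th ∕ `15`-th roots.  §3: at the levels `4` and `12` the compatible pair
`(e = 1, e = 1)` EXISTS (`u ↦ u mod 4` maps `{1, 5} ⊂ (ℤ/12)^×` onto `{1}`), so `Hom(X_4, X_{12}) ≠ 0 ≠ Hom(X_{12}, X_4)`.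

## What is proved

* §0 `forall_smul_mem_iff_iff_of_forall_comp_mem_iff`, **`traceField_eq_of_forall_comp_mem_iff`**,
  **`IsCMTypeRealisation.traceField_eq_of_exists_hom_ne_zero`**, `IsCMTypeRealisation.traceField_eq_of_isIsogenous`,
  `IsCMTypeRealisation.hom_eq_zero_of_traceField_ne`, **`IsCMTypeRealisation.orthogonal_of_traceField_ne`** (`Hom = 0` both
  ways and not isogenous either way), `IsCMTypeRealisation.hom_eq_zero_of_finrank_traceField_ne`.
* §1 `dvd_two_mul_of_isPrimitiveRoot_mem_traceField` (any type of `ℚ(ζ_m)`), `not_isPrimitiveRoot_of_mem_traceField_of_not_dvd`,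
  `totient_le_finrank_traceField_of_isPrimitiveRoot_mem`; `exists_isPrimitiveRoot_mem_traceField_odd ∕ _twiceOdd`;
  `traceField_eq_fieldRange_four`, `finrank_traceField_four`, `exists_isPrimitiveRoot_four_mem_traceField_four`;
  **`not_isPrimitiveRoot_of_mem_traceField_of_four_dvd`** (no odd-order roots of unity, `4 ∣ m ≥ 8` non-exceptional),
  `exists_isPrimitiveRoot_four_mem_traceField_of_not_eight_dvd` (`i ∈ K*` for `m ≡ 4 (mod 8)`),
  `not_isPrimitiveRoot_four_of_mem_traceField_of_eight_dvd` (`i ∉ K*` for `8 ∣ m`); `not_isPrimitiveRoot_of_mem_traceField_twenty`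
  ∕ `_twentyFour` (`n ≠ 3`) ∕ `_sixty` (`n ∉ {3, 5}`).
* §2 (realisations `A` of `Φ_d`, `A′` of `Φ_{d′}`; each theorem gives `Hom(A, A′) = 0 ∧ Hom(A′, A) = 0 ∧` not isogenous either way)
  **`orthogonal_odd_fourDvd`** (`d` odd `≥ 3`; `4 ∣ d′ ≥ 8`, `d′ ∉ {20,24,60}`), `orthogonal_twiceOdd_fourDvd`, `orthogonal_odd_four`,
  `orthogonal_twiceOdd_four`, `orthogonal_odd_twenty`, `orthogonal_twiceOdd_twenty`, `orthogonal_odd_twentyFour` (`d ≠ 3`),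
  `orthogonal_odd_sixty` (`d ∉ {3,5}`),
  `orthogonal_four_fourDvd_of_eight_dvd`, **`orthogonal_fourDvd_of_eight_dvd_of_not_eight_dvd`** (`Y_d ⟂ Y_{d′}` for `8 ∣ d`,
  `d′ ≡ 4 (mod 8)`), `orthogonal_fourDvd_of_totient_ne` (`φ(d) ≠ φ(d′)`), `orthogonal_four_sixty`.
* §3 `exists_compatible_four_twelve` (the compatible pair), **`exists_hom_ne_zero_four_twelve`**: for realisations `A₄` of `Φ_4`
  and `A₁₂` of `Φ_{12}`, `Hom(A₄, A₁₂) ≠ 0` AND `Hom(A₁₂, A₄) ≠ 0` (`not_forall_hom_eq_zero_four_twelve`: not orthogonal, equal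
  reflex fields) — the factors `X_4` (an elliptic curve with CM by `ℚ(i)`) and `X_{12} ∼ Y_{12}²` (`Y_{12}` with CM by
  `ℚ(ζ_{12} − ζ_{12}⁻¹) = ℚ(i)`) of `J_{12}, J_{24}, J_{36}, …` are NOT orthogonal: the printed list of pairwise non-isogenous
  factors cannot include both `X_4 = Y_4` and `Y_{12}` (Thm. 3.0 (5) at `d = 4` reads `X_4 ∼ Y_4²`, which is dimensionally
  impossible — `dim X_4 = φ(4)/2 = 1`; the tree's `HyperellipticJacobianLevelDivisibleByFour` accordingly assumes `8 ≤ m`).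

## Honest column ∕ NOT here

The print's sentence is typed as `Hom = 0` between REALISATIONS OF THE TYPES (every `X_d`, `Y_d^r` is covered); the curve and
`J_m` itself are not.  NOT separated here (equal reflex degrees, no root of unity distinguishes): `Y_d` vs `Y_{d′}` with
`φ(d) = φ(d′)` and `d ≡ d′ (mod 8)` (e.g. `(28, 36)`, `(32, 40)`); `X_3` vs `Y_{24}`, `X_3, X_5` vs `Y_{60}`; `X_4` vs `Y_{20}, Y_{24}`
and vs `Y_{d′}`, `d′ ≡ 4 (mod 8)`, `d′ ≥ 28`; `Y_8, Y_{12}` vs `Y_{20}, Y_{24}`; `Y_{16}` vs `Y_{60}`; `Y_{20}` vs `Y_{24}` — all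
asserted non-isogenous in print (conductor arguments), not typed.  The isogeny `X_{12} ∼ X_4²` itself (only `Hom ≠ 0` both
ways is typed).  `HC_CM` is not touched.

## References

* [GalleseGoodsonLombardo2024] A. Gallese, H. Goodson, D. Lombardo, arXiv:2405.20394 — §3 Thm. 3.0 (last statement, (5), (6)),
  §3.2 Lemma 12 and the paragraph after it, §3.4, §3.5 (sentence after Lemma 14).
* [Shimura1998] G. Shimura, *Abelian Varieties with Complex Multiplication and Modular Functions* (1998) — §8.3 Prop. 28, §8.4
  Example (1), §5.1 Prop. 3.
* [MilneCM2006] J. S. Milne, *Complex Multiplication* (2006) — Ch. I §1 Prop. 1.18 (c), §3 Prop. 3.13, §5 Prop. 5.2.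
* [DeligneMilne1982Tannakian] P. Deligne, J. S. Milne, LNM 900 II — §6 Thm. 6.20 (Riemann).
* [Washington1997] L. C. Washington, *Introduction to Cyclotomic Fields* — Thm. 2.5, and Cor. of Prop. 2.3 / Ex. 2.3 (roots of
  unity in `ℚ(ζ_n)`).

## Provenance

Cell `pub-hodgecm2` (COR-CM), KEPT Literature lane `lit-deligne-3` gen 51 (claim GGL24-CROSS-LEVEL-ORTHOGONALITY; count-neutral,
own lane).
-/

noncomputable section

open CategoryTheory NumberField Module

namespace Literature.AlgebraicGeometry.ComplexMultiplication

open Literature.AlgebraicGeometry.Motives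
open Literature.AlgebraicGeometry.HodgeTheory (complexBetti)
open Literature.NumberTheory.ComplexMultiplication

/-! ## §0 The reflex field `K* ⊂ ℂ` is an invariant of `Hom ≠ 0` (any CM pairs) -/

section ReflexInvariant

variable {K₀ K₁ : Type} [Field K₀] [NumberField K₀] [Field K₁] [NumberField K₁] {Φ₀ : CMType K₀} {Φ₁ : CMType K₁}

/-- **A compatible pair of embeddings forces equal stabilisers**: if `(s, t)` satisfies `τs ∈ Φ₀ ⟺ τt ∈ Φ₁` for all
`τ ∈ Aut(ℂ)`, then `gΦ₀ = Φ₀ ⟺ gΦ₁ = Φ₁` for every `g ∈ Aut(ℂ)` (every embedding is `τ ∘ s`, resp. `τ ∘ t`, by the transitivity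
of `Aut(ℂ)`; `g(τs) ∈ Φ₀ ⟺ (gτ)t ∈ Φ₁`). [cite: Shimura1998, §8.3 Prop. 28] [cite: MilneCM2006, Ch. I §1 Prop. 1.18 (c)] -/
theorem forall_smul_mem_iff_iff_of_forall_comp_mem_iff {s : K₀ →+* ℂ} {t : K₁ →+* ℂ}
    (hst : ∀ τ : ℂ ≃+* ℂ, (τ : ℂ →+* ℂ).comp s ∈ Φ₀.1 ↔ (τ : ℂ →+* ℂ).comp t ∈ Φ₁.1) (g : ℂ ≃+* ℂ) :
    (∀ χ : K₀ →+* ℂ, g • χ ∈ Φ₀.1 ↔ χ ∈ Φ₀.1) ↔ (∀ χ : K₁ →+* ℂ, g • χ ∈ Φ₁.1 ↔ χ ∈ Φ₁.1) := by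
  haveI : Countable K₀ := Countable.of_equiv _ (Module.finBasis ℚ K₀).equivFun.toEquiv.symm
  haveI : Countable K₁ := Countable.of_equiv _ (Module.finBasis ℚ K₁).equivFun.toEquiv.symm
  have hg : ∀ τ : ℂ ≃+* ℂ,
      (g • ((τ : ℂ →+* ℂ).comp s) ∈ Φ₀.1 ↔ g • ((τ : ℂ →+* ℂ).comp t) ∈ Φ₁.1) := by
    intro τ
    have h0 : g • ((τ : ℂ →+* ℂ).comp s) = ((g * τ : ℂ ≃+* ℂ) : ℂ →+* ℂ).comp s := RingHom.ext fun _ => rfl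
    have h1 : g • ((τ : ℂ →+* ℂ).comp t) = ((g * τ : ℂ ≃+* ℂ) : ℂ →+* ℂ).comp t := RingHom.ext fun _ => rfl
    rw [h0, h1]
    exact hst (g * τ)
  constructor
  · intro h χ
    obtain ⟨τ, hτ⟩ := ZarhinLie.exists_ringEquiv_complex_comp_eq t χ
    have hχ : χ = (τ : ℂ →+* ℂ).comp t := RingHom.ext fun a => (hτ a).symm
    rw [hχ, ← hg τ, ← hst τ]
    exact h _
  · intro h χ
    obtain ⟨τ, hτ⟩ := ZarhinLie.exists_ringEquiv_complex_comp_eq s χ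
    have hχ : χ = (τ : ℂ →+* ℂ).comp s := RingHom.ext fun a => (hτ a).symm
    rw [hχ, hg τ, hst τ]
    exact h _

/-- **A compatible pair of embeddings forces EQUAL REFLEX FIELDS `ℚ(tr Φ₀) = ℚ(tr Φ₁) ⊂ ℂ`** — `K*` is the fixed field of the
stabiliser `{τ | τΦ = Φ}` (Prop. 28, tree `mem_traceField_iff_forall_smul_mem_iff`), and the stabilisers agree.
[cite: Shimura1998, §8.3 Prop. 28] [cite: MilneCM2006, Ch. I §1 Prop. 1.18 (c)] -/
theorem traceField_eq_of_forall_comp_mem_iff {s : K₀ →+* ℂ} {t : K₁ →+* ℂ}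
    (hst : ∀ τ : ℂ ≃+* ℂ, (τ : ℂ →+* ℂ).comp s ∈ Φ₀.1 ↔ (τ : ℂ →+* ℂ).comp t ∈ Φ₁.1) :
    traceField Φ₀ = traceField Φ₁ := by
  refine IntermediateField.ext fun z => ?_
  rw [mem_traceField_iff_forall_smul_mem_iff, mem_traceField_iff_forall_smul_mem_iff]
  exact forall_congr' fun τ => by rw [forall_smul_mem_iff_iff_of_forall_comp_mem_iff hst τ]

variable {A₀ A₁ : AbelianVariety ℂ} {ι₀ : 𝓞 K₀ →+* End A₀} {θ₀ : K₀ →+* Module.End ℂ (complexBetti A₀.X 1)}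
  {ι₁ : 𝓞 K₁ →+* End A₁} {θ₁ : K₁ →+* Module.End ℂ (complexBetti A₁.X 1)}

/-- **`Hom(A₀, A₁) ≠ 0 ⟹ K*(Φ₀) = K*(Φ₁)`**: the reflex field in `ℂ` is the same for two CM abelian varieties (CM by possibly
different fields `K₀`, `K₁`, types `Φ₀`, `Φ₁`) admitting a non-zero homomorphism — `Hom ≠ 0` iff a compatible pair exists
(Riemann, tree `IsCMTypeRealisation.exists_hom_ne_zero_iff`), and a compatible pair forces equal reflex fields.
[cite: MilneCM2006, Ch. I §1 Prop. 1.18 (c), §3 Prop. 3.13 and §5 Prop. 5.2] [cite: Shimura1998, §8.3 Prop. 28]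
[cite: DeligneMilne1982Tannakian, II §6 Thm. 6.20 (Riemann)] -/
theorem IsCMTypeRealisation.traceField_eq_of_exists_hom_ne_zero (h₀ : IsCMTypeRealisation Φ₀ A₀ ι₀ θ₀)
    (h₁ : IsCMTypeRealisation Φ₁ A₁ ι₁ θ₁) (hne : ∃ u : A₀ ⟶ A₁, u ≠ 0) : traceField Φ₀ = traceField Φ₁ := by
  obtain ⟨s, t, hst⟩ := (h₀.exists_hom_ne_zero_iff h₁).1 hne
  exact traceField_eq_of_forall_comp_mem_iff hst

/-- **Isogenous CM abelian varieties have the same reflex field in `ℂ`.** [cite: MilneCM2006, Ch. I §1 Prop. 1.18 (c) and §3 Prop. 3.12]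
[cite: Shimura1998, §8.3 Prop. 28] -/
theorem IsCMTypeRealisation.traceField_eq_of_isIsogenous (h₀ : IsCMTypeRealisation Φ₀ A₀ ι₀ θ₀)
    (h₁ : IsCMTypeRealisation Φ₁ A₁ ι₁ θ₁) (hiso : AbelianVariety.IsIsogenous A₀ A₁) : traceField Φ₀ = traceField Φ₁ := by
  obtain ⟨s, t, hst⟩ := h₀.exists_forall_comp_mem_iff_of_isIsogenous h₁ hiso
  exact traceField_eq_of_forall_comp_mem_iff hst

/-- **Different reflex fields ⟹ `Hom(A₀, A₁) = 0`.** [cite: MilneCM2006, Ch. I §1 Prop. 1.18 (c) and §3 Prop. 3.13]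
[cite: Shimura1998, §8.3 Prop. 28] -/
theorem IsCMTypeRealisation.hom_eq_zero_of_traceField_ne (h₀ : IsCMTypeRealisation Φ₀ A₀ ι₀ θ₀)
    (h₁ : IsCMTypeRealisation Φ₁ A₁ ι₁ θ₁) (hne : traceField Φ₀ ≠ traceField Φ₁) (u : A₀ ⟶ A₁) : u = 0 := by
  by_contra hu
  exact hne (h₀.traceField_eq_of_exists_hom_ne_zero h₁ ⟨u, hu⟩)

/-- **Different reflex fields ⟹ ORTHOGONAL**: `Hom(A₀, A₁) = 0`, `Hom(A₁, A₀) = 0`, and `A₀`, `A₁` are not isogenous (either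
way round). [cite: MilneCM2006, Ch. I §1 Prop. 1.18 (c) and §3 Prop. 3.13] [cite: Shimura1998, §8.3 Prop. 28] -/
theorem IsCMTypeRealisation.orthogonal_of_traceField_ne (h₀ : IsCMTypeRealisation Φ₀ A₀ ι₀ θ₀)
    (h₁ : IsCMTypeRealisation Φ₁ A₁ ι₁ θ₁) (hne : traceField Φ₀ ≠ traceField Φ₁) :
    (∀ u : A₀ ⟶ A₁, u = 0) ∧ (∀ v : A₁ ⟶ A₀, v = 0) ∧
      ¬ AbelianVariety.IsIsogenous A₀ A₁ ∧ ¬ AbelianVariety.IsIsogenous A₁ A₀ :=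
  ⟨h₀.hom_eq_zero_of_traceField_ne h₁ hne, h₁.hom_eq_zero_of_traceField_ne h₀ (Ne.symm hne),
    fun h => hne (h₀.traceField_eq_of_isIsogenous h₁ h), fun h => hne (h₁.traceField_eq_of_isIsogenous h₀ h).symm⟩

/-- **Different reflex DEGREES `[K*(Φ₀) : ℚ] ≠ [K*(Φ₁) : ℚ]` ⟹ `Hom(A₀, A₁) = 0`.** [cite: MilneCM2006, Ch. I §1 Prop. 1.18 (c) and §3 Prop. 3.13] -/
theorem IsCMTypeRealisation.hom_eq_zero_of_finrank_traceField_ne (h₀ : IsCMTypeRealisation Φ₀ A₀ ι₀ θ₀)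
    (h₁ : IsCMTypeRealisation Φ₁ A₁ ι₁ θ₁) (hne : finrank ℚ (traceField Φ₀) ≠ finrank ℚ (traceField Φ₁)) (u : A₀ ⟶ A₁) :
    u = 0 :=
  h₀.hom_eq_zero_of_traceField_ne h₁ (fun h => hne (by rw [h])) u

/-- **A root of unity present in one reflex field and absent from the other ⟹ orthogonal.** [cite: MilneCM2006, Ch. I §1 Prop. 1.18 (c)
and §3 Prop. 3.13] [cite: Shimura1998, §8.3 Prop. 28] -/
theorem IsCMTypeRealisation.orthogonal_of_isPrimitiveRoot (h₀ : IsCMTypeRealisation Φ₀ A₀ ι₀ θ₀)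
    (h₁ : IsCMTypeRealisation Φ₁ A₁ ι₁ θ₁) {n : ℕ} (hy : ∃ y ∈ traceField Φ₀, IsPrimitiveRoot y n)
    (hno : ∀ y ∈ traceField Φ₁, ¬ IsPrimitiveRoot y n) :
    (∀ u : A₀ ⟶ A₁, u = 0) ∧ (∀ v : A₁ ⟶ A₀, v = 0) ∧
      ¬ AbelianVariety.IsIsogenous A₀ A₁ ∧ ¬ AbelianVariety.IsIsogenous A₁ A₀ := by
  refine h₀.orthogonal_of_traceField_ne h₁ fun heq => ?_
  obtain ⟨y, hy, hyn⟩ := hy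
  exact hno y (heq ▸ hy) hyn

/-- The same with the root of unity on the other side. [cite: MilneCM2006, Ch. I §1 Prop. 1.18 (c) and §3 Prop. 3.13] -/
theorem IsCMTypeRealisation.orthogonal_of_isPrimitiveRoot' (h₀ : IsCMTypeRealisation Φ₀ A₀ ι₀ θ₀)
    (h₁ : IsCMTypeRealisation Φ₁ A₁ ι₁ θ₁) {n : ℕ} (hno : ∀ y ∈ traceField Φ₀, ¬ IsPrimitiveRoot y n)
    (hy : ∃ y ∈ traceField Φ₁, IsPrimitiveRoot y n) :
    (∀ u : A₀ ⟶ A₁, u = 0) ∧ (∀ v : A₁ ⟶ A₀, v = 0) ∧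
      ¬ AbelianVariety.IsIsogenous A₀ A₁ ∧ ¬ AbelianVariety.IsIsogenous A₁ A₀ := by
  obtain ⟨h1, h2, h3, h4⟩ := h₁.orthogonal_of_isPrimitiveRoot h₀ hy hno
  exact ⟨h2, h1, h4, h3⟩

/-- Different reflex degrees ⟹ orthogonal. [cite: MilneCM2006, Ch. I §1 Prop. 1.18 (c) and §3 Prop. 3.13] -/
theorem IsCMTypeRealisation.orthogonal_of_finrank_traceField_ne (h₀ : IsCMTypeRealisation Φ₀ A₀ ι₀ θ₀)
    (h₁ : IsCMTypeRealisation Φ₁ A₁ ι₁ θ₁) (hne : finrank ℚ (traceField Φ₀) ≠ finrank ℚ (traceField Φ₁)) :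
    (∀ u : A₀ ⟶ A₁, u = 0) ∧ (∀ v : A₁ ⟶ A₀, v = 0) ∧
      ¬ AbelianVariety.IsIsogenous A₀ A₁ ∧ ¬ AbelianVariety.IsIsogenous A₁ A₀ :=
  h₀.orthogonal_of_traceField_ne h₁ fun h => hne (by rw [h])

end ReflexInvariant

namespace HyperellipticJacobian

open Literature.AlgebraicGeometry.Pohlmann1968 Literature.AlgebraicGeometry.Pohlmann1968.Cyclotomic

/-! ## §1 Roots of unity in the reflex fields of the types of `ℚ(ζ_m)` -/

section Degree

variable {K : Type} [Field K] [NumberField K]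

/-- **`φ(n) ≤ [K* : ℚ]`** if the reflex field contains a primitive `n`-th root of unity (`ℚ(y) ⊆ K*`, `[ℚ(y) : ℚ] = φ(n)`).
[cite: Washington1997, Thm. 2.5] -/
theorem totient_le_finrank_traceField_of_isPrimitiveRoot_mem (Φ : CMType K) {y : ℂ} (hy : y ∈ traceField Φ) {n : ℕ}
    (hn : 0 < n) (hyn : IsPrimitiveRoot y n) : Nat.totient n ≤ finrank ℚ (traceField Φ) := by
  haveI : FiniteDimensional ℚ (traceField Φ) := Module.finite_of_finrank_pos (finrank_traceField_pos Φ)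
  have hint : IsIntegral ℚ y := IsIntegral.of_pow hn (by rw [hyn.pow_eq_one]; exact isIntegral_one)
  have hdeg : finrank ℚ (IntermediateField.adjoin ℚ {y}) = Nat.totient n := by
    rw [IntermediateField.adjoin.finrank hint, ← Polynomial.cyclotomic_eq_minpoly_rat hyn hn, Polynomial.natDegree_cyclotomic]
  rw [← hdeg]
  exact IntermediateField.finrank_le_of_le_right (IntermediateField.adjoin_simple_le_iff.2 hy)

end Degree

section AnyLevel

variable (m : ℕ) [NeZero m] {K : Type} [Field K] [NumberField K] [IsCyclotomicExtension {m} ℚ K]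

/-- **A primitive `n`-th root of unity in the reflex field of a type of `ℚ(ζ_m)` has `n ∣ 2m`**: `K* ⊂ x(ℚ(ζ_m))` (`ℚ(ζ_m)` is
Galois; tree `traceField_le_fieldRange`) and the roots of unity of `ℚ(ζ_m)` have order dividing `2m`.
[cite: Shimura1998, §8.3 Prop. 28] [cite: Washington1997, Ch. 2 (Ex. 2.3)] -/
theorem dvd_two_mul_of_isPrimitiveRoot_mem_traceField (Φ : CMType K) {y : ℂ} (hy : y ∈ traceField Φ) {n : ℕ} (hn : n ≠ 0)
    (hyn : IsPrimitiveRoot y n) : n ∣ 2 * m := by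
  haveI : IsAbelianGalois ℚ K := IsCyclotomicExtension.isAbelianGalois {m} ℚ K
  obtain ⟨x⟩ := (inferInstance : Nonempty (K →+* ℂ))
  obtain ⟨η, rfl⟩ := AlgHom.mem_fieldRange.1 (traceField_le_fieldRange (AlgHom.id ℚ K) x Φ hy)
  exact ((show IsPrimitiveRoot (x η) n from hyn).of_map_of_injective x.injective).dvd_of_isCyclotomicExtension m hn

/-- No primitive `n`-th root of unity, `n` odd with `n ∤ m`, lies in the reflex field of a type of `ℚ(ζ_m)`.
[cite: Washington1997, Ch. 2 (Ex. 2.3)] [cite: Shimura1998, §8.3 Prop. 28] -/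
theorem not_isPrimitiveRoot_of_mem_traceField_of_not_dvd (Φ : CMType K) {y : ℂ} (hy : y ∈ traceField Φ) {n : ℕ}
    (hn : Odd n) (hnm : ¬ n ∣ m) : ¬ IsPrimitiveRoot y n := fun hyn =>
  hnm (Nat.Coprime.dvd_of_dvd_mul_left hn.coprime_two_right
    (by simpa [mul_comm] using dvd_two_mul_of_isPrimitiveRoot_mem_traceField m Φ hy (by rintro rfl; simp at hn) hyn))

end AnyLevel

section Odd

variable {m : ℕ} [NeZero m] {K : Type} [Field K] [NumberField K] [IsCyclotomicExtension {m} ℚ K]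

/-- **`m` odd: `K*(Φ_m) = x(ℚ(ζ_m))` contains a primitive `m`-th root of unity** (namely `x ζ_m`).
[cite: GalleseGoodsonLombardo2024, §3.5 Prop. 13 (proof)] [cite: Shimura1998, §8.4 Example (1)] -/
theorem exists_isPrimitiveRoot_mem_traceField_odd (hm : Odd m) (Φ : CMType K)
    (hΦ : ∀ σ : K →+* ℂ, σ ∈ Φ.1 ↔ 2 * (expOf m K σ).val < m) : ∃ y ∈ traceField Φ, IsPrimitiveRoot y m := by
  obtain ⟨x⟩ := (inferInstance : Nonempty (K →+* ℂ))
  refine ⟨x (zetaOf m K), ?_, (IsCyclotomicExtension.zeta_spec m ℚ K).map_of_injective x.injective⟩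
  rw [traceField_eq_fieldRange_odd hm Φ hΦ x, AlgHom.mem_fieldRange]
  exact ⟨zetaOf m K, rfl⟩

end Odd

section TwiceOdd

variable {n : ℕ} [NeZero n] [NeZero (2 * n)] {L : Type} [Field L] [NumberField L] [IsCyclotomicExtension {2 * n} ℚ L]

/-- **`m = 2n`, `n` odd `≥ 3`: `K*(Φ_{2n}) = x(ℚ(ζ_{2n}))` contains a primitive `n`-th root of unity** (`x ζ²`).
[cite: GalleseGoodsonLombardo2024, §3.5 Prop. 13 (proof)] [cite: Shimura1998, §8.4 Example (1)] -/
theorem exists_isPrimitiveRoot_mem_traceField_twiceOdd (hn : Odd n) (h3 : 3 ≤ n) (Φ : CMType L)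
    (hΦ : ∀ σ : L →+* ℂ, σ ∈ Φ.1 ↔ 2 * (expOf (2 * n) L σ).val < 2 * n) : ∃ y ∈ traceField Φ, IsPrimitiveRoot y n := by
  obtain ⟨x⟩ := (inferInstance : Nonempty (L →+* ℂ))
  have hζ := IsCyclotomicExtension.zeta_spec (2 * n) ℚ L
  have h2 : IsPrimitiveRoot (zetaOf (2 * n) L ^ 2) n := by
    have := hζ.pow_of_dvd (p := 2) two_ne_zero (dvd_mul_right 2 n)
    rwa [Nat.mul_div_cancel_left n two_pos] at this
  refine ⟨x (zetaOf (2 * n) L ^ 2), ?_, h2.map_of_injective x.injective⟩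
  rw [traceField_eq_fieldRange_twiceOdd hn h3 Φ hΦ x, AlgHom.mem_fieldRange]
  exact ⟨_, rfl⟩

end TwiceOdd

section Four

variable {K : Type} [Field K] [NumberField K] [IsCyclotomicExtension {4} ℚ K]

/-- `[ℚ(ζ_4) : ℚ] = 2`. [folklore] -/
private theorem finrank_eq_two_four : finrank ℚ K = 2 := by
  haveI : NeZero (4 : ℕ) := ⟨by norm_num⟩
  rw [IsCyclotomicExtension.finrank (K := ℚ) (n := 4) K (Polynomial.cyclotomic.irreducible_rat (by norm_num))]
  decide +kernel

/-- **Level `4`: the reflex field of ANY type of `ℚ(ζ_4) = ℚ(i)` is `x(ℚ(i))`** (every type of an imaginary quadratic field is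
primitive, tree `CMTypeLattice.primitive_of_finrank_eq_two`; Shimura §8.4 Example (1)). [cite: Shimura1998, §8.4 Example (1)] -/
theorem traceField_eq_fieldRange_four (Φ : CMType K) (x : K →+* ℂ) : traceField Φ = x.toRatAlgHom.fieldRange := by
  haveI : NeZero (4 : ℕ) := ⟨by norm_num⟩
  haveI : IsAbelianGalois ℚ K := IsCyclotomicExtension.isAbelianGalois {4} ℚ K
  have hprim : IsPrimitive (ℂ ≃+* ℂ) Φ.1 x :=
    (isPrimitive_ringEquiv_complex_iff Φ x).2 (CMTypeLattice.primitive_of_finrank_eq_two Φ finrank_eq_two_four)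
  exact traceField_eq_fieldRange_of_isPrimitive_of_isAbelianGalois x Φ hprim

/-- `[K*(Φ) : ℚ] = 2` at level `4`. [cite: Shimura1998, §8.4 Example (1)] -/
theorem finrank_traceField_four (Φ : CMType K) : finrank ℚ (traceField Φ) = 2 := by
  obtain ⟨x⟩ := (inferInstance : Nonempty (K →+* ℂ))
  have hfr : finrank ℚ x.toRatAlgHom.fieldRange = finrank ℚ K := by
    rw [← IntermediateField.finrank_eq_finrank_subalgebra, AlgHom.fieldRange_toSubalgebra]
    exact (AlgEquiv.ofInjectiveField x.toRatAlgHom).toLinearEquiv.finrank_eq.symm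
  rw [traceField_eq_fieldRange_four Φ x, hfr, finrank_eq_two_four]

/-- **`i ∈ K*(Φ)` at level `4`**: the reflex field contains a primitive `4`-th root of unity. [cite: Shimura1998, §8.4 Example (1)] -/
theorem exists_isPrimitiveRoot_four_mem_traceField_four (Φ : CMType K) : ∃ y ∈ traceField Φ, IsPrimitiveRoot y 4 := by
  haveI : NeZero (4 : ℕ) := ⟨by norm_num⟩
  obtain ⟨x⟩ := (inferInstance : Nonempty (K →+* ℂ))
  refine ⟨x (zetaOf 4 K), ?_, (IsCyclotomicExtension.zeta_spec 4 ℚ K).map_of_injective x.injective⟩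
  rw [traceField_eq_fieldRange_four Φ x, AlgHom.mem_fieldRange]
  exact ⟨zetaOf 4 K, rfl⟩

/-- No root of unity of odd order `≥ 3` lies in a reflex field at level `4` (`n ∣ 8` is impossible for odd `n ≥ 3`).
[cite: Washington1997, Ch. 2 (Ex. 2.3)] -/
theorem not_isPrimitiveRoot_of_mem_traceField_four (Φ : CMType K) {y : ℂ} (hy : y ∈ traceField Φ) {n : ℕ} (hn : Odd n)
    (h3 : 3 ≤ n) : ¬ IsPrimitiveRoot y n := by
  haveI : NeZero (4 : ℕ) := ⟨by norm_num⟩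
  refine not_isPrimitiveRoot_of_mem_traceField_of_not_dvd 4 Φ hy hn fun h => ?_
  have h4 : n ≤ 4 := Nat.le_of_dvd (by norm_num) h
  interval_cases n
  · exact absurd h (by decide)
  · exact absurd hn (by decide)

end Four

section FourDvd

variable {m : ℕ} [NeZero m] {K : Type} [Field K] [NumberField K] [IsCyclotomicExtension {m} ℚ K]

/-- Bookkeeping for `4 ∣ m ≥ 8`, `m ∉ {20, 24, 60}`: an element of `K*(Φ_m)` is `x η` with `η` fixed by the involution `σ`,
`σ ζ = −ζ⁻¹` (tree `eq_fixedField_and_eq_adjoin_of_primitive_of_four_dvd`, `traceField_eq_map_of_primitive_subpair`).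
[cite: GalleseGoodsonLombardo2024, §3 Thm. 3.0 (5) and §3.2 Lemma 12] [cite: Shimura1998, §8.4 Example (1)] -/
private theorem exists_eq_of_mem_traceField_of_four_dvd (h4 : 4 ∣ m) (h8 : 8 ≤ m) (h20 : m ≠ 20) (h24 : m ≠ 24) (h60 : m ≠ 60)
    (Φ : CMType K) (hΦ : ∀ σ : K →+* ℂ, σ ∈ Φ.1 ↔ 2 * (expOf m K σ).val < m) (x : K →+* ℂ) {y : ℂ}
    (hy : y ∈ traceField Φ) :
    ∃ (σ : K ≃ₐ[ℚ] K) (η : K), σ (zetaOf m K) = -(zetaOf m K)⁻¹ ∧ σ η = η ∧ x η = y := by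
  haveI : IsAbelianGalois ℚ K := IsCyclotomicExtension.isAbelianGalois {m} ℚ K
  obtain ⟨K₁, Φ₁, h₁, hp₁, -⟩ := exists_primitive_inducedCMType_index_two_of_four_dvd h4 h8 h20 h24 h60 Φ hΦ
  obtain ⟨σ, hσζ, -, hfix, -⟩ := eq_fixedField_and_eq_adjoin_of_primitive_of_four_dvd h4 h8 h20 h24 h60 Φ hΦ Φ₁ h₁ hp₁
  rw [traceField_eq_map_of_primitive_subpair Φ Φ₁ h₁ hp₁ x, IntermediateField.mem_map] at hy
  obtain ⟨η, hη, rfl⟩ := hy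
  exact ⟨σ, η, hσζ, (hfix η).1 hη, rfl⟩

/-- The same bookkeeping in the other direction: `x η ∈ K*(Φ_m)` for every `η` fixed by `σ`.
[cite: GalleseGoodsonLombardo2024, §3 Thm. 3.0 (5) and §3.2 Lemma 12] [cite: Shimura1998, §8.4 Example (1)] -/
private theorem exists_involution_of_four_dvd (h4 : 4 ∣ m) (h8 : 8 ≤ m) (h20 : m ≠ 20) (h24 : m ≠ 24) (h60 : m ≠ 60)
    (Φ : CMType K) (hΦ : ∀ σ : K →+* ℂ, σ ∈ Φ.1 ↔ 2 * (expOf m K σ).val < m) (x : K →+* ℂ) :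
    ∃ σ : K ≃ₐ[ℚ] K, σ (zetaOf m K) = -(zetaOf m K)⁻¹ ∧ ∀ η : K, σ η = η → x η ∈ traceField Φ := by
  haveI : IsAbelianGalois ℚ K := IsCyclotomicExtension.isAbelianGalois {m} ℚ K
  obtain ⟨K₁, Φ₁, h₁, hp₁, -⟩ := exists_primitive_inducedCMType_index_two_of_four_dvd h4 h8 h20 h24 h60 Φ hΦ
  obtain ⟨σ, hσζ, -, hfix, -⟩ := eq_fixedField_and_eq_adjoin_of_primitive_of_four_dvd h4 h8 h20 h24 h60 Φ hΦ Φ₁ h₁ hp₁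
  refine ⟨σ, hσζ, fun η hη => ?_⟩
  rw [traceField_eq_map_of_primitive_subpair Φ Φ₁ h₁ hp₁ x, IntermediateField.mem_map]
  exact ⟨η, (hfix η).2 hη, rfl⟩

omit [NeZero m] [IsCyclotomicExtension {m} ℚ K] in
/-- The involution on powers of `ζ`: `σ ζ = −ζ⁻¹` and `σ(ζ^j) = ζ^j` give `(ζ^j)² = (−1)^j`. [folklore] -/
private theorem pow_sq_eq_of_fixed {ζ : K} (hζ0 : ζ ≠ 0) (σ : K ≃ₐ[ℚ] K) (hσζ : σ ζ = -ζ⁻¹) {j : ℕ}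
    (hfix : σ (ζ ^ j) = ζ ^ j) : (ζ ^ j) ^ 2 = (-1) ^ j := by
  rw [map_pow, hσζ] at hfix
  have h1 : (-ζ⁻¹) ^ j * ζ ^ j = (-1 : K) ^ j := by
    rw [← mul_pow, neg_mul, inv_mul_cancel₀ hζ0]
  rw [hfix] at h1
  rw [sq, h1]

omit [NeZero m] [IsCyclotomicExtension {m} ℚ K] in
/-- … hence `ζ^{4j} = 1`. [folklore] -/
private theorem pow_four_mul_eq_one_of_fixed {ζ : K} (hζ0 : ζ ≠ 0) (σ : K ≃ₐ[ℚ] K) (hσζ : σ ζ = -ζ⁻¹) {j : ℕ}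
    (hfix : σ (ζ ^ j) = ζ ^ j) : ζ ^ (4 * j) = 1 := by
  have h := pow_sq_eq_of_fixed hζ0 σ hσζ hfix
  calc ζ ^ (4 * j) = ((ζ ^ j) ^ 2) ^ 2 := by ring
    _ = 1 := by rw [h, ← pow_mul, mul_comm, pow_mul, neg_one_sq, one_pow]

/-- **`4 ∣ m ≥ 8`, `m ∉ {20, 24, 60}`: the reflex field `K*(Φ_m) = x(ℚ(ζ_m − ζ_m⁻¹))` contains NO root of unity of odd order
`n ≥ 3`** — such a root `η ∈ K₁ ⊂ ℚ(ζ_m)` has `n ∣ m`, so `η = ζ^j`; `σ η = η` with `σ ζ = −ζ⁻¹` forces `ζ^{4j} = 1`, `η⁴ = 1`,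
`n ∣ 4`. [cite: GalleseGoodsonLombardo2024, §3 Thm. 3.0 (5) and §3.2 Lemma 12] [cite: Washington1997, Ch. 2 (Ex. 2.3)] -/
theorem not_isPrimitiveRoot_of_mem_traceField_of_four_dvd (h4 : 4 ∣ m) (h8 : 8 ≤ m) (h20 : m ≠ 20) (h24 : m ≠ 24)
    (h60 : m ≠ 60) (Φ : CMType K) (hΦ : ∀ σ : K →+* ℂ, σ ∈ Φ.1 ↔ 2 * (expOf m K σ).val < m) {y : ℂ}
    (hy : y ∈ traceField Φ) {n : ℕ} (hn : Odd n) (h3 : 3 ≤ n) : ¬ IsPrimitiveRoot y n := by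
  intro hyn
  obtain ⟨x⟩ := (inferInstance : Nonempty (K →+* ℂ))
  obtain ⟨σ, η, hσζ, hση, rfl⟩ := exists_eq_of_mem_traceField_of_four_dvd h4 h8 h20 h24 h60 Φ hΦ x hy
  have hη : IsPrimitiveRoot η n := hyn.of_map_of_injective x.injective
  have hζ := IsCyclotomicExtension.zeta_spec m ℚ K
  have hn0 : n ≠ 0 := by omega
  have hnm : n ∣ m :=
    Nat.Coprime.dvd_of_dvd_mul_left hn.coprime_two_right (by simpa [mul_comm] using hη.dvd_of_isCyclotomicExtension m hn0)
  obtain ⟨j, -, hj⟩ := hζ.eq_pow_of_pow_eq_one ((hη.pow_eq_one_iff_dvd m).2 hnm)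
  rw [← hj] at hση hη
  have h4j := pow_four_mul_eq_one_of_fixed (hζ.ne_zero (NeZero.ne m)) σ hσζ hση
  have hn4 : n ∣ 4 := (hη.pow_eq_one_iff_dvd 4).1 (by rw [← pow_mul, mul_comm]; exact h4j)
  have hle : n ≤ 4 := Nat.le_of_dvd (by norm_num) hn4
  interval_cases n
  · exact absurd hn4 (by decide)
  · exact absurd hn (by decide)

/-- **`m ≡ 4 (mod 8)`, `m ≥ 12`, `m ∉ {20, 60}`: `i ∈ K*(Φ_m)`** — `η = ζ^{m/4}` has `η² = ζ^{m/2} = −1` and is fixed by `σ`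
(`σ η = −η⁻¹ = η` as `m/4` is odd), so `x η ∈ x(K₁) = K*` is a primitive `4`-th root of unity.
[cite: GalleseGoodsonLombardo2024, §3 Thm. 3.0 (5) and §3.2 Lemma 12] [cite: Washington1997, Ch. 2 (Ex. 2.3)] -/
theorem exists_isPrimitiveRoot_four_mem_traceField_of_not_eight_dvd (h4 : 4 ∣ m) (h8 : 8 ≤ m) (h20 : m ≠ 20)
    (h60 : m ≠ 60) (h8n : ¬ 8 ∣ m) (Φ : CMType K) (hΦ : ∀ σ : K →+* ℂ, σ ∈ Φ.1 ↔ 2 * (expOf m K σ).val < m) :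
    ∃ y ∈ traceField Φ, IsPrimitiveRoot y 4 := by
  have h24 : m ≠ 24 := by rintro rfl; exact h8n ⟨3, rfl⟩
  obtain ⟨x⟩ := (inferInstance : Nonempty (K →+* ℂ))
  obtain ⟨σ, hσζ, hmem⟩ := exists_involution_of_four_dvd h4 h8 h20 h24 h60 Φ hΦ x
  obtain ⟨e, he⟩ : ∃ e, m = 8 * e + 4 := by
    obtain ⟨q, rfl⟩ := h4
    exact ⟨q / 2, by omega⟩
  set ζ := zetaOf m K with hζdef
  have hζ : IsPrimitiveRoot ζ m := IsCyclotomicExtension.zeta_spec m ℚ K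
  have hζ0 : ζ ≠ 0 := hζ.ne_zero (NeZero.ne m)
  have hη4 : IsPrimitiveRoot (ζ ^ (2 * e + 1)) 4 := by
    have h := hζ.pow_of_dvd (p := 2 * e + 1) (by omega) ⟨4, by omega⟩
    rwa [show m / (2 * e + 1) = 4 from Nat.div_eq_of_eq_mul_left (by omega) (by omega)] at h
  have hm2 : ζ ^ (m / 2) = -1 := (hζ.pow (NeZero.pos m) (show m = m / 2 * 2 by omega)).eq_neg_one_of_two_right
  have hη2 : (ζ ^ (2 * e + 1)) ^ 2 = -1 := by
    rw [← pow_mul, show (2 * e + 1) * 2 = m / 2 by omega, hm2]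
  have hinv : (ζ ^ (2 * e + 1))⁻¹ = -(ζ ^ (2 * e + 1)) :=
    inv_eq_of_mul_eq_one_right (by rw [mul_neg, ← sq, hη2, neg_neg])
  have hησ : σ (ζ ^ (2 * e + 1)) = ζ ^ (2 * e + 1) := by
    rw [map_pow, hσζ, neg_pow, inv_pow, Odd.neg_one_pow ⟨e, rfl⟩, hinv]
    ring
  exact ⟨x (ζ ^ (2 * e + 1)), hmem _ hησ, hη4.map_of_injective x.injective⟩

/-- **`8 ∣ m`, `m ≠ 24`: `i ∉ K*(Φ_m)`** — a primitive `4`-th root `η ∈ K₁` is `ζ^j` with `(ζ^j)² = (−1)^j` and `m ∣ 4j`, so `j`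
is even and `η² = 1`, absurd. [cite: GalleseGoodsonLombardo2024, §3 Thm. 3.0 (5) and §3.2 Lemma 12] [cite: Washington1997, Ch. 2 (Ex. 2.3)] -/
theorem not_isPrimitiveRoot_four_of_mem_traceField_of_eight_dvd (h8d : 8 ∣ m) (h24 : m ≠ 24) (Φ : CMType K)
    (hΦ : ∀ σ : K →+* ℂ, σ ∈ Φ.1 ↔ 2 * (expOf m K σ).val < m) {y : ℂ} (hy : y ∈ traceField Φ) :
    ¬ IsPrimitiveRoot y 4 := by
  have h4 : 4 ∣ m := dvd_trans ⟨2, rfl⟩ h8d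
  have h8 : 8 ≤ m := Nat.le_of_dvd (NeZero.pos m) h8d
  have h20 : m ≠ 20 := by rintro rfl; revert h8d; decide
  have h60 : m ≠ 60 := by rintro rfl; revert h8d; decide
  intro hy4
  obtain ⟨x⟩ := (inferInstance : Nonempty (K →+* ℂ))
  obtain ⟨σ, η, hσζ, hση, rfl⟩ := exists_eq_of_mem_traceField_of_four_dvd h4 h8 h20 h24 h60 Φ hΦ x hy
  have hη : IsPrimitiveRoot η 4 := hy4.of_map_of_injective x.injective
  have hζ := IsCyclotomicExtension.zeta_spec m ℚ K
  obtain ⟨j, -, hj⟩ := hζ.eq_pow_of_pow_eq_one ((hη.pow_eq_one_iff_dvd m).2 h4)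
  rw [← hj] at hση hη
  have hζ0 := hζ.ne_zero (NeZero.ne m)
  have hsq := pow_sq_eq_of_fixed hζ0 σ hσζ hση
  have hm4j : m ∣ 4 * j := (hζ.pow_eq_one_iff_dvd _).1 (pow_four_mul_eq_one_of_fixed hζ0 σ hσζ hση)
  have hj2 : Even j := by
    obtain ⟨c, hc⟩ := h8d
    obtain ⟨d, hd⟩ := hm4j
    have hj' : j = 2 * (c * d) := Nat.eq_of_mul_eq_mul_left (show 0 < 4 by norm_num) (by rw [hd, hc]; ring)
    exact ⟨c * d, by rw [hj']; ring⟩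
  have h2 : (zetaOf m K ^ j) ^ 2 = 1 := by rw [hsq, hj2.neg_one_pow]
  exact hη.pow_ne_one_of_pos_of_lt (by norm_num) (by norm_num) h2

end FourDvd

section Exceptional

variable {K : Type} [Field K] [NumberField K]

/-- **Level `20`: `K*(Φ_{20}) = ℚ(√−5)` (degree `2`) contains no root of unity of odd order `n ≥ 3`** (`n ∣ 40` forces `n = 5`, and
`φ(5) = 4 > 2`). [cite: GalleseGoodsonLombardo2024, §3.4 and §3.5 Lemma 14 (`F_{20} = ℚ(√−5)`)] [cite: Washington1997, Thm. 2.5] -/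
theorem not_isPrimitiveRoot_of_mem_traceField_twenty [IsCyclotomicExtension {20} ℚ K] (Φ : CMType K)
    (hΦ : ∀ σ : K →+* ℂ, σ ∈ Φ.1 ↔ 2 * (expOf 20 K σ).val < 20) {y : ℂ} (hy : y ∈ traceField Φ) {n : ℕ} (hn : Odd n)
    (h3 : 3 ≤ n) : ¬ IsPrimitiveRoot y n := by
  haveI : NeZero (20 : ℕ) := ⟨by norm_num⟩
  intro hyn
  obtain ⟨x⟩ := (inferInstance : Nonempty (K →+* ℂ))
  obtain ⟨-, -, hfr, -⟩ := traceField_twenty Φ hΦ x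
  have h40 : n ∣ 2 * 20 := dvd_two_mul_of_isPrimitiveRoot_mem_traceField 20 Φ hy (by omega) hyn
  have hle := totient_le_finrank_traceField_of_isPrimitiveRoot_mem Φ hy (by omega) hyn
  rw [hfr] at hle
  have hn40 : n ≤ 40 := Nat.le_of_dvd (by norm_num) h40
  interval_cases n <;>
    first
    | exact absurd h40 (by decide)
    | exact absurd hn (by decide)
    | exact absurd hle (by decide +kernel)

/-- **Level `24`: `K*(Φ_{24}) = ℚ(√−6)` contains no root of unity of odd order `n ≥ 3`, `n ≠ 3`** (`n ∣ 48` forces `n = 3`; the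
case `n = 3` — `ℚ(√−6) ≠ ℚ(√−3)` — is not typed here). [cite: GalleseGoodsonLombardo2024, §3.4 (`F_{24} = ℚ(√−6)`)]
[cite: Washington1997, Ch. 2 (Ex. 2.3)] -/
theorem not_isPrimitiveRoot_of_mem_traceField_twentyFour [IsCyclotomicExtension {24} ℚ K] (Φ : CMType K) {y : ℂ}
    (hy : y ∈ traceField Φ) {n : ℕ} (hn : Odd n) (h3 : 3 ≤ n) (hn3 : n ≠ 3) : ¬ IsPrimitiveRoot y n := by
  haveI : NeZero (24 : ℕ) := ⟨by norm_num⟩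
  refine not_isPrimitiveRoot_of_mem_traceField_of_not_dvd 24 Φ hy hn fun h => ?_
  have hle : n ≤ 24 := Nat.le_of_dvd (by norm_num) h
  interval_cases n <;>
    first
    | exact absurd h (by decide)
    | exact absurd hn (by decide)
    | exact hn3 rfl

/-- **Level `60`: `K*(Φ_{60}) = F_{60}` (degree `4`) contains no root of unity of odd order `n ≥ 3`, `n ∉ {3, 5}`** (`n ∣ 120`
forces `n ∈ {3, 5, 15}`, and `φ(15) = 8 > 4`; `n = 3, 5` are not typed here). [cite: GalleseGoodsonLombardo2024, §3.4 (`F_{60}`)]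
[cite: Washington1997, Thm. 2.5] -/
theorem not_isPrimitiveRoot_of_mem_traceField_sixty [IsCyclotomicExtension {60} ℚ K] (Φ : CMType K)
    (hΦ : ∀ σ : K →+* ℂ, σ ∈ Φ.1 ↔ 2 * (expOf 60 K σ).val < 60) {y : ℂ} (hy : y ∈ traceField Φ) {n : ℕ} (hn : Odd n)
    (h3 : 3 ≤ n) (hn3 : n ≠ 3) (hn5 : n ≠ 5) : ¬ IsPrimitiveRoot y n := by
  haveI : NeZero (60 : ℕ) := ⟨by norm_num⟩
  intro hyn
  obtain ⟨x⟩ := (inferInstance : Nonempty (K →+* ℂ))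
  obtain ⟨-, -, hfr, -⟩ := traceField_sixty Φ hΦ x
  have h120 : n ∣ 2 * 60 := dvd_two_mul_of_isPrimitiveRoot_mem_traceField 60 Φ hy (by omega) hyn
  have hle := totient_le_finrank_traceField_of_isPrimitiveRoot_mem Φ hy (by omega) hyn
  rw [hfr] at hle
  have hn120 : n ≤ 120 := Nat.le_of_dvd (by norm_num) h120
  interval_cases n <;>
    first
    | exact absurd h120 (by decide)
    | exact absurd hn (by decide)
    | exact hn3 rfl
    | exact hn5 rfl
    | exact absurd hle (by decide +kernel)

end Exceptional

/-! ## §2 Orthogonality across parities: realisations of `Φ_d` and `Φ_{d′}` have `Hom = 0` both ways -/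

section CrossLevel

variable {d : ℕ} [NeZero d] {K : Type} [Field K] [NumberField K] [IsCyclotomicExtension {d} ℚ K] {Φ : CMType K}
  {A : AbelianVariety ℂ} {ι : 𝓞 K →+* End A} {θ : K →+* Module.End ℂ (complexBetti A.X 1)}
  {d' : ℕ} [NeZero d'] {K' : Type} [Field K'] [NumberField K'] [IsCyclotomicExtension {d'} ℚ K'] {Φ' : CMType K'}
  {A' : AbelianVariety ℂ} {ι' : 𝓞 K' →+* End A'} {θ' : K' →+* Module.End ℂ (complexBetti A'.X 1)}

/-- **THM. 3.0, last statement, `X_d` (`d` odd `≥ 3`) vs `Y_{d′}` (`4 ∣ d′ ≥ 8`, `d′ ∉ {20, 24, 60}`)**: every realisation `A` of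
`Φ_d` and every realisation `A′` of `Φ_{d′}` (so `X_{d′}`, `Y_{d′}`-powers) are ORTHOGONAL — `Hom(A, A′) = 0`, `Hom(A′, A) = 0`, not
isogenous (`K*(Φ_d) ∋` a primitive `d`-th root of unity, `K*(Φ_{d′})` has none of odd order).
[cite: GalleseGoodsonLombardo2024, §3 Thm. 3.0 (last statement) and §3.5 (after Lemma 14)] [cite: MilneCM2006, Ch. I §3 Prop. 3.13]
[cite: Shimura1998, §8.3 Prop. 28] -/
theorem orthogonal_odd_fourDvd (hd : Odd d) (h3 : 3 ≤ d) (hΦ : ∀ σ : K →+* ℂ, σ ∈ Φ.1 ↔ 2 * (expOf d K σ).val < d)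
    (hA : IsCMTypeRealisation Φ A ι θ) (h4 : 4 ∣ d') (h8 : 8 ≤ d') (h20 : d' ≠ 20) (h24 : d' ≠ 24) (h60 : d' ≠ 60)
    (hΦ' : ∀ σ : K' →+* ℂ, σ ∈ Φ'.1 ↔ 2 * (expOf d' K' σ).val < d') (hA' : IsCMTypeRealisation Φ' A' ι' θ') :
    (∀ u : A ⟶ A', u = 0) ∧ (∀ v : A' ⟶ A, v = 0) ∧
      ¬ AbelianVariety.IsIsogenous A A' ∧ ¬ AbelianVariety.IsIsogenous A' A :=
  hA.orthogonal_of_isPrimitiveRoot hA' (exists_isPrimitiveRoot_mem_traceField_odd hd Φ hΦ)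
    fun _ hy => not_isPrimitiveRoot_of_mem_traceField_of_four_dvd h4 h8 h20 h24 h60 Φ' hΦ' hy hd h3

/-- **`X_d` (`d` odd `≥ 3`) vs `X_4`** (any type of `ℚ(ζ_4)`): orthogonal. [cite: GalleseGoodsonLombardo2024, §3 Thm. 3.0 (last statement)]
[cite: MilneCM2006, Ch. I §3 Prop. 3.13] -/
theorem orthogonal_odd_four [IsCyclotomicExtension {4} ℚ K'] (hd : Odd d) (h3 : 3 ≤ d)
    (hΦ : ∀ σ : K →+* ℂ, σ ∈ Φ.1 ↔ 2 * (expOf d K σ).val < d) (hA : IsCMTypeRealisation Φ A ι θ)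
    (hA' : IsCMTypeRealisation Φ' A' ι' θ') :
    (∀ u : A ⟶ A', u = 0) ∧ (∀ v : A' ⟶ A, v = 0) ∧
      ¬ AbelianVariety.IsIsogenous A A' ∧ ¬ AbelianVariety.IsIsogenous A' A :=
  hA.orthogonal_of_isPrimitiveRoot hA' (exists_isPrimitiveRoot_mem_traceField_odd hd Φ hΦ)
    fun _ hy => not_isPrimitiveRoot_of_mem_traceField_four Φ' hy hd h3

/-- **`X_d` (`d` odd `≥ 3`) vs `Y_{20}`**: orthogonal (all odd `d`). [cite: GalleseGoodsonLombardo2024, §3 Thm. 3.0 (last statement) and §3.4]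
[cite: MilneCM2006, Ch. I §3 Prop. 3.13] -/
theorem orthogonal_odd_twenty [IsCyclotomicExtension {20} ℚ K'] (hd : Odd d) (h3 : 3 ≤ d)
    (hΦ : ∀ σ : K →+* ℂ, σ ∈ Φ.1 ↔ 2 * (expOf d K σ).val < d) (hA : IsCMTypeRealisation Φ A ι θ)
    (hΦ' : ∀ σ : K' →+* ℂ, σ ∈ Φ'.1 ↔ 2 * (expOf 20 K' σ).val < 20) (hA' : IsCMTypeRealisation Φ' A' ι' θ') :
    (∀ u : A ⟶ A', u = 0) ∧ (∀ v : A' ⟶ A, v = 0) ∧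
      ¬ AbelianVariety.IsIsogenous A A' ∧ ¬ AbelianVariety.IsIsogenous A' A :=
  hA.orthogonal_of_isPrimitiveRoot hA' (exists_isPrimitiveRoot_mem_traceField_odd hd Φ hΦ)
    fun _ hy => not_isPrimitiveRoot_of_mem_traceField_twenty Φ' hΦ' hy hd h3

/-- **`X_d` (`d` odd `≥ 3`, `d ≠ 3`) vs `Y_{24}`**: orthogonal (any type of `ℚ(ζ_{24})`). [cite: GalleseGoodsonLombardo2024, §3 Thm. 3.0 (last statement) and §3.4]
[cite: MilneCM2006, Ch. I §3 Prop. 3.13] -/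
theorem orthogonal_odd_twentyFour [IsCyclotomicExtension {24} ℚ K'] (hd : Odd d) (h3 : 3 ≤ d) (hd3 : d ≠ 3)
    (hΦ : ∀ σ : K →+* ℂ, σ ∈ Φ.1 ↔ 2 * (expOf d K σ).val < d) (hA : IsCMTypeRealisation Φ A ι θ)
    (hA' : IsCMTypeRealisation Φ' A' ι' θ') :
    (∀ u : A ⟶ A', u = 0) ∧ (∀ v : A' ⟶ A, v = 0) ∧
      ¬ AbelianVariety.IsIsogenous A A' ∧ ¬ AbelianVariety.IsIsogenous A' A :=
  hA.orthogonal_of_isPrimitiveRoot hA' (exists_isPrimitiveRoot_mem_traceField_odd hd Φ hΦ)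
    fun _ hy => not_isPrimitiveRoot_of_mem_traceField_twentyFour Φ' hy hd h3 hd3

/-- **`X_d` (`d` odd `≥ 3`, `d ∉ {3, 5}`) vs `Y_{60}`**: orthogonal. [cite: GalleseGoodsonLombardo2024, §3 Thm. 3.0 (last statement) and §3.4]
[cite: MilneCM2006, Ch. I §3 Prop. 3.13] -/
theorem orthogonal_odd_sixty [IsCyclotomicExtension {60} ℚ K'] (hd : Odd d) (h3 : 3 ≤ d) (hd3 : d ≠ 3) (hd5 : d ≠ 5)
    (hΦ : ∀ σ : K →+* ℂ, σ ∈ Φ.1 ↔ 2 * (expOf d K σ).val < d) (hA : IsCMTypeRealisation Φ A ι θ)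
    (hΦ' : ∀ σ : K' →+* ℂ, σ ∈ Φ'.1 ↔ 2 * (expOf 60 K' σ).val < 60) (hA' : IsCMTypeRealisation Φ' A' ι' θ') :
    (∀ u : A ⟶ A', u = 0) ∧ (∀ v : A' ⟶ A, v = 0) ∧
      ¬ AbelianVariety.IsIsogenous A A' ∧ ¬ AbelianVariety.IsIsogenous A' A :=
  hA.orthogonal_of_isPrimitiveRoot hA' (exists_isPrimitiveRoot_mem_traceField_odd hd Φ hΦ)
    fun _ hy => not_isPrimitiveRoot_of_mem_traceField_sixty Φ' hΦ' hy hd h3 hd3 hd5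

/-- **`X_4` vs `Y_{d′}` for `8 ∣ d′`, `d′ ≠ 24`**: orthogonal (`i ∈ K*(Φ_4)`, `i ∉ K*(Φ_{d′})`).
[cite: GalleseGoodsonLombardo2024, §3 Thm. 3.0 (last statement)] [cite: MilneCM2006, Ch. I §3 Prop. 3.13] -/
theorem orthogonal_four_fourDvd_of_eight_dvd [IsCyclotomicExtension {4} ℚ K] (hA : IsCMTypeRealisation Φ A ι θ)
    (h8d : 8 ∣ d') (h24 : d' ≠ 24) (hΦ' : ∀ σ : K' →+* ℂ, σ ∈ Φ'.1 ↔ 2 * (expOf d' K' σ).val < d')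
    (hA' : IsCMTypeRealisation Φ' A' ι' θ') :
    (∀ u : A ⟶ A', u = 0) ∧ (∀ v : A' ⟶ A, v = 0) ∧
      ¬ AbelianVariety.IsIsogenous A A' ∧ ¬ AbelianVariety.IsIsogenous A' A :=
  hA.orthogonal_of_isPrimitiveRoot hA' (exists_isPrimitiveRoot_four_mem_traceField_four Φ)
    fun _ hy => not_isPrimitiveRoot_four_of_mem_traceField_of_eight_dvd h8d h24 Φ' hΦ' hy

/-- **`Y_d` vs `Y_{d′}` for `8 ∣ d` (`d ≠ 24`) and `d′ ≡ 4 (mod 8)`, `d′ ≥ 8`, `d′ ∉ {20, 60}`**: orthogonal (`i ∉ K*(Φ_d)`,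
`i ∈ K*(Φ_{d′})`). [cite: GalleseGoodsonLombardo2024, §3 Thm. 3.0 (last statement)] [cite: MilneCM2006, Ch. I §3 Prop. 3.13] -/
theorem orthogonal_fourDvd_of_eight_dvd_of_not_eight_dvd (h8d : 8 ∣ d) (h24 : d ≠ 24)
    (hΦ : ∀ σ : K →+* ℂ, σ ∈ Φ.1 ↔ 2 * (expOf d K σ).val < d) (hA : IsCMTypeRealisation Φ A ι θ)
    (h4 : 4 ∣ d') (h8 : 8 ≤ d') (h20 : d' ≠ 20) (h60 : d' ≠ 60) (h8n : ¬ 8 ∣ d')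
    (hΦ' : ∀ σ : K' →+* ℂ, σ ∈ Φ'.1 ↔ 2 * (expOf d' K' σ).val < d') (hA' : IsCMTypeRealisation Φ' A' ι' θ') :
    (∀ u : A ⟶ A', u = 0) ∧ (∀ v : A' ⟶ A, v = 0) ∧
      ¬ AbelianVariety.IsIsogenous A A' ∧ ¬ AbelianVariety.IsIsogenous A' A :=
  hA.orthogonal_of_isPrimitiveRoot' hA' (fun _ hy => not_isPrimitiveRoot_four_of_mem_traceField_of_eight_dvd h8d h24 Φ hΦ hy)
    (exists_isPrimitiveRoot_four_mem_traceField_of_not_eight_dvd h4 h8 h20 h60 h8n Φ' hΦ')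

/-- **`Y_d` vs `Y_{d′}` with `φ(d) ≠ φ(d′)`** (`4 ∣ d, d′ ≥ 8`, both `∉ {20, 24, 60}`): orthogonal (reflex degrees `φ(d)/2 ≠ φ(d′)/2`).
[cite: GalleseGoodsonLombardo2024, §3 Thm. 3.0 (last statement)] [cite: MilneCM2006, Ch. I §3 Prop. 3.13] -/
theorem orthogonal_fourDvd_of_totient_ne (h4 : 4 ∣ d) (h8 : 8 ≤ d) (h20 : d ≠ 20) (h24 : d ≠ 24) (h60 : d ≠ 60)
    (hΦ : ∀ σ : K →+* ℂ, σ ∈ Φ.1 ↔ 2 * (expOf d K σ).val < d) (hA : IsCMTypeRealisation Φ A ι θ)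
    (h4' : 4 ∣ d') (h8' : 8 ≤ d') (h20' : d' ≠ 20) (h24' : d' ≠ 24) (h60' : d' ≠ 60)
    (hΦ' : ∀ σ : K' →+* ℂ, σ ∈ Φ'.1 ↔ 2 * (expOf d' K' σ).val < d') (hA' : IsCMTypeRealisation Φ' A' ι' θ')
    (hne : Nat.totient d ≠ Nat.totient d') :
    (∀ u : A ⟶ A', u = 0) ∧ (∀ v : A' ⟶ A, v = 0) ∧
      ¬ AbelianVariety.IsIsogenous A A' ∧ ¬ AbelianVariety.IsIsogenous A' A := by
  refine hA.orthogonal_of_finrank_traceField_ne hA' fun h => hne ?_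
  rw [← two_mul_finrank_traceField_of_four_dvd h4 h8 h20 h24 h60 Φ hΦ,
    ← two_mul_finrank_traceField_of_four_dvd h4' h8' h20' h24' h60' Φ' hΦ', h]

/-- **`X_4` vs `Y_{60}`**: orthogonal (reflex degrees `2 ≠ 4`). [cite: GalleseGoodsonLombardo2024, §3 Thm. 3.0 (last statement) and §3.4]
[cite: MilneCM2006, Ch. I §3 Prop. 3.13] -/
theorem orthogonal_four_sixty [IsCyclotomicExtension {4} ℚ K] [IsCyclotomicExtension {60} ℚ K']
    (hA : IsCMTypeRealisation Φ A ι θ) (hΦ' : ∀ σ : K' →+* ℂ, σ ∈ Φ'.1 ↔ 2 * (expOf 60 K' σ).val < 60)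
    (hA' : IsCMTypeRealisation Φ' A' ι' θ') :
    (∀ u : A ⟶ A', u = 0) ∧ (∀ v : A' ⟶ A, v = 0) ∧
      ¬ AbelianVariety.IsIsogenous A A' ∧ ¬ AbelianVariety.IsIsogenous A' A := by
  obtain ⟨x⟩ := (inferInstance : Nonempty (K' →+* ℂ))
  obtain ⟨-, -, hfr, -⟩ := traceField_sixty Φ' hΦ' x
  refine hA.orthogonal_of_finrank_traceField_ne hA' ?_
  rw [finrank_traceField_four Φ, hfr]
  decide

end CrossLevel

section CrossLevelTwiceOdd

variable {n : ℕ} [NeZero n] [NeZero (2 * n)] {L : Type} [Field L] [NumberField L] [IsCyclotomicExtension {2 * n} ℚ L]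
  {Ψ : CMType L} {A : AbelianVariety ℂ} {ι : 𝓞 L →+* End A} {θ : L →+* Module.End ℂ (complexBetti A.X 1)}
  {d' : ℕ} [NeZero d'] {K' : Type} [Field K'] [NumberField K'] [IsCyclotomicExtension {d'} ℚ K'] {Φ' : CMType K'}
  {A' : AbelianVariety ℂ} {ι' : 𝓞 K' →+* End A'} {θ' : K' →+* Module.End ℂ (complexBetti A'.X 1)}

/-- **`X_{2n}` (`n` odd `≥ 3`) vs `Y_{d′}` (`4 ∣ d′ ≥ 8`, `d′ ∉ {20, 24, 60}`)**: orthogonal.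
[cite: GalleseGoodsonLombardo2024, §3 Thm. 3.0 (last statement) and (4)] [cite: MilneCM2006, Ch. I §3 Prop. 3.13] -/
theorem orthogonal_twiceOdd_fourDvd (hn : Odd n) (h3 : 3 ≤ n)
    (hΨ : ∀ σ : L →+* ℂ, σ ∈ Ψ.1 ↔ 2 * (expOf (2 * n) L σ).val < 2 * n) (hA : IsCMTypeRealisation Ψ A ι θ)
    (h4 : 4 ∣ d') (h8 : 8 ≤ d') (h20 : d' ≠ 20) (h24 : d' ≠ 24) (h60 : d' ≠ 60)
    (hΦ' : ∀ σ : K' →+* ℂ, σ ∈ Φ'.1 ↔ 2 * (expOf d' K' σ).val < d') (hA' : IsCMTypeRealisation Φ' A' ι' θ') :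
    (∀ u : A ⟶ A', u = 0) ∧ (∀ v : A' ⟶ A, v = 0) ∧
      ¬ AbelianVariety.IsIsogenous A A' ∧ ¬ AbelianVariety.IsIsogenous A' A :=
  hA.orthogonal_of_isPrimitiveRoot hA' (exists_isPrimitiveRoot_mem_traceField_twiceOdd hn h3 Ψ hΨ)
    fun _ hy => not_isPrimitiveRoot_of_mem_traceField_of_four_dvd h4 h8 h20 h24 h60 Φ' hΦ' hy hn h3

/-- **`X_{2n}` (`n` odd `≥ 3`) vs `X_4`**: orthogonal. [cite: GalleseGoodsonLombardo2024, §3 Thm. 3.0 (last statement) and (4)]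
[cite: MilneCM2006, Ch. I §3 Prop. 3.13] -/
theorem orthogonal_twiceOdd_four [IsCyclotomicExtension {4} ℚ K'] (hn : Odd n) (h3 : 3 ≤ n)
    (hΨ : ∀ σ : L →+* ℂ, σ ∈ Ψ.1 ↔ 2 * (expOf (2 * n) L σ).val < 2 * n) (hA : IsCMTypeRealisation Ψ A ι θ)
    (hA' : IsCMTypeRealisation Φ' A' ι' θ') :
    (∀ u : A ⟶ A', u = 0) ∧ (∀ v : A' ⟶ A, v = 0) ∧
      ¬ AbelianVariety.IsIsogenous A A' ∧ ¬ AbelianVariety.IsIsogenous A' A :=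
  hA.orthogonal_of_isPrimitiveRoot hA' (exists_isPrimitiveRoot_mem_traceField_twiceOdd hn h3 Ψ hΨ)
    fun _ hy => not_isPrimitiveRoot_of_mem_traceField_four Φ' hy hn h3

/-- **`X_{2n}` (`n` odd `≥ 3`) vs `Y_{20}`**: orthogonal. [cite: GalleseGoodsonLombardo2024, §3 Thm. 3.0 (last statement), (4) and §3.4]
[cite: MilneCM2006, Ch. I §3 Prop. 3.13] -/
theorem orthogonal_twiceOdd_twenty [IsCyclotomicExtension {20} ℚ K'] (hn : Odd n) (h3 : 3 ≤ n)
    (hΨ : ∀ σ : L →+* ℂ, σ ∈ Ψ.1 ↔ 2 * (expOf (2 * n) L σ).val < 2 * n) (hA : IsCMTypeRealisation Ψ A ι θ)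
    (hΦ' : ∀ σ : K' →+* ℂ, σ ∈ Φ'.1 ↔ 2 * (expOf 20 K' σ).val < 20) (hA' : IsCMTypeRealisation Φ' A' ι' θ') :
    (∀ u : A ⟶ A', u = 0) ∧ (∀ v : A' ⟶ A, v = 0) ∧
      ¬ AbelianVariety.IsIsogenous A A' ∧ ¬ AbelianVariety.IsIsogenous A' A :=
  hA.orthogonal_of_isPrimitiveRoot hA' (exists_isPrimitiveRoot_mem_traceField_twiceOdd hn h3 Ψ hΨ)
    fun _ hy => not_isPrimitiveRoot_of_mem_traceField_twenty Φ' hΦ' hy hn h3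

end CrossLevelTwiceOdd

/-! ## §3 The pair `(4, 12)`: `Hom(X_4, X_{12}) ≠ 0` — the compatible pair `(e = 1, e = 1)` -/

section FourTwelve

variable {K₄ : Type} [Field K₄] [NumberField K₄] [IsCyclotomicExtension {4} ℚ K₄] {Φ₄ : CMType K₄}
  {A₄ : AbelianVariety ℂ} {ι₄ : 𝓞 K₄ →+* End A₄} {θ₄ : K₄ →+* Module.End ℂ (complexBetti A₄.X 1)}
  {K₁₂ : Type} [Field K₁₂] [NumberField K₁₂] [IsCyclotomicExtension {12} ℚ K₁₂] {Φ₁₂ : CMType K₁₂}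
  {A₁₂ : AbelianVariety ℂ} {ι₁₂ : 𝓞 K₁₂ →+* End A₁₂} {θ₁₂ : K₁₂ →+* Module.End ℂ (complexBetti A₁₂.X 1)}

/-- The finite fact behind the pair `(4, 12)`: for a unit `u` of `ℤ/12`, `2⟨u mod 4⟩ < 4 ⟺ 2⟨u⟩ < 12` (`{1, 5} ↦ 1`,
`{7, 11} ↦ 3`). [folklore] -/
private theorem half_four_iff_half_twelve : ∀ u : ZMod 12, u.val.Coprime 12 →
    (2 * (ZMod.castHom (show 4 ∣ 12 by norm_num) (ZMod 4) u).val < 4 ↔ 2 * u.val < 12) := by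
  decide +kernel

/-- **A compatible pair for `(Φ_4, Φ_{12})`**: the embeddings of exponent `1` at the two levels satisfy `τs ∈ Φ_4 ⟺ τt ∈ Φ_{12}`
for every `τ ∈ Aut(ℂ)` — the cyclotomic characters are compatible (`u_4(τ) = u_{12}(τ) mod 4`, tree `castHom_autExp`) and
`u mod 4 = 1 ⟺ u ∈ {1, 5}` on `(ℤ/12)^×`, i.e. the lower half `{1, 5}` of level `12` is the fibre of the lower half `{1}` of
level `4` (`Φ_{12}` is induced from `ℚ(i) = ℚ(ζ_{12} − ζ_{12}⁻¹)`). [cite: GalleseGoodsonLombardo2024, §3 Thm. 3.0 (5) and §3.2 Lemma 12]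
[cite: Washington1997, Thm. 2.5] -/
theorem exists_compatible_four_twelve (hΦ₄ : ∀ σ : K₄ →+* ℂ, σ ∈ Φ₄.1 ↔ 2 * (expOf 4 K₄ σ).val < 4)
    (hΦ₁₂ : ∀ σ : K₁₂ →+* ℂ, σ ∈ Φ₁₂.1 ↔ 2 * (expOf 12 K₁₂ σ).val < 12) :
    ∃ (s : K₄ →+* ℂ) (t : K₁₂ →+* ℂ), ∀ τ : ℂ ≃+* ℂ,
      (τ : ℂ →+* ℂ).comp s ∈ Φ₄.1 ↔ (τ : ℂ →+* ℂ).comp t ∈ Φ₁₂.1 := by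
  haveI : NeZero (4 : ℕ) := ⟨by norm_num⟩
  haveI : NeZero (12 : ℕ) := ⟨by norm_num⟩
  obtain ⟨s, hs⟩ := exists_expOf_eq (N := 4) (L := K₄) 1 (by decide +kernel)
  obtain ⟨t, ht⟩ := exists_expOf_eq (N := 12) (L := K₁₂) 1 (by decide +kernel)
  refine ⟨s, t, fun τ => ?_⟩
  rw [hΦ₄, hΦ₁₂, expOf_comp, expOf_comp, hs, ht, mul_one, mul_one,
    ← castHom_autExp 4 12 (show 4 ∣ 12 by norm_num) τ]
  exact half_four_iff_half_twelve _ (coprime_autExp 12 τ)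

/-- **`Hom(X_4, X_{12}) ≠ 0` and `Hom(X_{12}, X_4) ≠ 0`**: for every realisation `A₄` of the lower-half type `Φ_4` of `ℚ(ζ_4)`
and every realisation `A₁₂` of the lower-half type `Φ_{12}` of `ℚ(ζ_{12})` there are non-zero homomorphisms both ways
(Riemann, tree `IsCMTypeRealisation.exists_hom_ne_zero_iff`, and the compatible pair above).  So the factors `X_4` (`= Y_4`,
an elliptic curve with CM by `ℚ(i)`) and `X_{12} ∼ Y_{12}²` (`Y_{12}` with CM by `ℚ(ζ_{12} − ζ_{12}⁻¹) = ℚ(i)`) of `J_m`, `12 ∣ m`,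
are NOT orthogonal — a refinement of the printed «all `X_d` with odd `d` and all `Y_d` are pairwise non-isogenous» at the
pair `(Y_4, Y_{12})`. [cite: GalleseGoodsonLombardo2024, §3 Thm. 3.0 (last statement) and (5)] [cite: MilneCM2006, Ch. I §3 Prop. 3.13 and §5 Prop. 5.2]
[cite: DeligneMilne1982Tannakian, II §6 Thm. 6.20 (Riemann)] -/
theorem exists_hom_ne_zero_four_twelve (hΦ₄ : ∀ σ : K₄ →+* ℂ, σ ∈ Φ₄.1 ↔ 2 * (expOf 4 K₄ σ).val < 4)
    (hA₄ : IsCMTypeRealisation Φ₄ A₄ ι₄ θ₄)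
    (hΦ₁₂ : ∀ σ : K₁₂ →+* ℂ, σ ∈ Φ₁₂.1 ↔ 2 * (expOf 12 K₁₂ σ).val < 12) (hA₁₂ : IsCMTypeRealisation Φ₁₂ A₁₂ ι₁₂ θ₁₂) :
    (∃ u : A₄ ⟶ A₁₂, u ≠ 0) ∧ (∃ v : A₁₂ ⟶ A₄, v ≠ 0) := by
  obtain ⟨s, t, hst⟩ := exists_compatible_four_twelve (Φ₄ := Φ₄) (Φ₁₂ := Φ₁₂) hΦ₄ hΦ₁₂
  exact ⟨(hA₄.exists_hom_ne_zero_iff hA₁₂).2 ⟨s, t, hst⟩,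
    (hA₁₂.exists_hom_ne_zero_iff hA₄).2 ⟨t, s, fun τ => (hst τ).symm⟩⟩

/-- … in particular `A₄` and `A₁₂` are NOT orthogonal, and their reflex fields in `ℂ` coincide.
[cite: GalleseGoodsonLombardo2024, §3 Thm. 3.0 (5)] [cite: MilneCM2006, Ch. I §1 Prop. 1.18 (c)] -/
theorem not_forall_hom_eq_zero_four_twelve (hΦ₄ : ∀ σ : K₄ →+* ℂ, σ ∈ Φ₄.1 ↔ 2 * (expOf 4 K₄ σ).val < 4)
    (hA₄ : IsCMTypeRealisation Φ₄ A₄ ι₄ θ₄)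
    (hΦ₁₂ : ∀ σ : K₁₂ →+* ℂ, σ ∈ Φ₁₂.1 ↔ 2 * (expOf 12 K₁₂ σ).val < 12) (hA₁₂ : IsCMTypeRealisation Φ₁₂ A₁₂ ι₁₂ θ₁₂) :
    ¬ (∀ u : A₄ ⟶ A₁₂, u = 0) ∧ ¬ (∀ v : A₁₂ ⟶ A₄, v = 0) ∧ traceField Φ₄ = traceField Φ₁₂ := by
  obtain ⟨⟨u, hu⟩, ⟨v, hv⟩⟩ := exists_hom_ne_zero_four_twelve hΦ₄ hA₄ hΦ₁₂ hA₁₂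
  exact ⟨fun h => hu (h u), fun h => hv (h v), hA₄.traceField_eq_of_exists_hom_ne_zero hA₁₂ ⟨u, hu⟩⟩

end FourTwelve

end HyperellipticJacobian

end Literature.AlgebraicGeometry.ComplexMultiplication

end
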